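import Literature.NumberTheory.GaloisRepresentations.LubinTateFormalGroupTaylorOne
import Literature.NumberTheory.GaloisRepresentations.LubinTateColemanResidualLift
import Literature.NumberTheory.GaloisRepresentations.LubinTateColemanLogDeriv
import Literature.NumberTheory.GaloisRepresentations.PowerSeriesLogDerivCharP
import Mathlib.RingTheory.PowerSeries.Expand
import Mathlib.FieldTheory.Finite.Basic
import HarnessLib

/-!
# Coleman's logarithmic derivative is surjective modulo `π` onto the `𝒮`-eigenseries when `q = 2`
# (de Shalit I §3.12, Lemma and Corollary, residue characteristic two)

De Shalit, *Iwasawa theory of elliptic curves with complex multiplication* (1987), Ch. I §3.12: Lemma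
("`X(1+X)⁻¹·𝓔 mod 𝔭' = Image(∂)`") and Corollary ("`δ` maps `{𝒩g = g^φ}` ONTO `{𝒮h = h^φ}`"), proved there for
`𝐆̂_m` over unramified `𝒪'` by an explicit computation of `𝒮` modulo `𝔭'` on monomials.  Here, for
`f = πX + X²` over the valuation ring of ANY local field `F` with residue field of TWO elements (e.g. `F = ℚ₂`,
any uniformiser `π` — the case of the crux `TwoVariableMainConjAtSplitTwo(Quad)`, `K_v = ℚ₂`), the FIRST STEP of
the Corollary is **proved directly, without the reduction to `𝐆̂_m`**:

* ★★★ `exists_colemanNorm_eq_sub_logDeriv_mem` — **if `𝒮h = π·h` then `h ≡ δg (mod π)` for some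
  `𝒩`-invariant unit `g`** (`δ = logDeriv hπ`, `ω_F · g'/g`).

Ingredients (all in the tree): the eigen-equation modulo `π`, `h̄(X²) = ū h̄ + ω̄_F h̄'`
(`redSeries_expand_two_of_colemanTrace_eq`, from `(𝒮h)∘f ≡ 2h − π ω_F h' (mod π²)` of
`LubinTateFormalGroupTaylorOne.lean` and `h∘f ≡ h(X^q) (mod π)`), Cartier's criterion (`PowerSeriesLogDerivCharP.lean`),
the `𝒩`-invariant lift (`LubinTateColemanResidualLift.lean`, `exists_colemanNorm_eq_redSeries_eq`), `δ(ℳ_f) ⊆ 𝓔_π`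
(`LubinTateColemanLogDeriv.lean`), and a characteristic-`2` coefficient lemma (`PowerSeries.eq_zero_of_expand_two_eq`:
`t = w·s`, `s` odd-supported, `w(0) ≠ 0`, `t(X²) = u t + w t'` force `s = 0`) replacing de Shalit's monomial
computation — valid for every form of `𝐆̂_m` over `𝔽₂` (the reduction of `F_f` is a non-trivial form when `π ≠ 2`).
Everything is proved (0 sorry).

## References

* E. de Shalit, *Iwasawa theory of elliptic curves with complex multiplication* (1987), Ch. I §3.12 Lemma,
  Corollary; §3.10 Lemma. [deShalit1987]
* R. Coleman, *Division values in local fields*, Invent. Math. 53 (1979). [Coleman1979]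
-/

noncomputable section

open scoped PowerSeries.WithPiTopology

/-! ## Coleman's `δ` is surjective modulo `π` onto the `𝒮`-eigenseries when `q = 2`
(de Shalit I §3.12 Lemma + Corollary, first step, at residue characteristic two) -/

namespace PowerSeries

/-! ### A coefficient lemma in characteristic two -/

variable {K : Type*} [Field K]

/-- The product `w · s` has the same first non-vanishing coefficient index as `s` when `w(0) ≠ 0`:
coefficients of `w s` below the first non-zero coefficient of `s` vanish. [folklore] -/
private theorem coeff_mul_eq_zero_of_lt {w s : K⟦X⟧} {m : ℕ} (hlt : ∀ d < m, coeff d s = 0) :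
    ∀ b < m, coeff b (w * s) = 0 := by
  intro b hb
  rw [coeff_mul]
  refine Finset.sum_eq_zero fun x hx => ?_
  have : x.2 < m := by have := Finset.mem_antidiagonal.mp hx; omega
  rw [hlt x.2 this, mul_zero]

/-- … and the first one is `w(0) · s_m`. [folklore] -/
private theorem coeff_mul_eq_of_lt {w s : K⟦X⟧} {m : ℕ} (hlt : ∀ d < m, coeff d s = 0) :
    coeff m (w * s) = constantCoeff w * coeff m s := by
  classical
  rw [coeff_mul, Finset.sum_eq_single (0, m)]
  · rw [coeff_zero_eq_constantCoeff]
  · intro x hx hne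
    have hx' := Finset.mem_antidiagonal.mp hx
    have : x.2 < m := by
      by_contra hge
      push Not at hge
      have h2 : x.2 = m := by omega
      have h1 : x.1 = 0 := by omega
      exact hne (Prod.ext h1 h2)
    rw [hlt x.2 this, mul_zero]
  · intro h
    exact absurd (Finset.mem_antidiagonal.mpr (by simp)) h

/-- ★ **The characteristic-`2` contradiction** (de Shalit I §3.12, `p = 2` reading): over a field of
characteristic `2`, if `s` has only odd exponents, `w(0) ≠ 0`, and `t = w·s` satisfies the eigen-equation
`t(X²) = u·t + w·t'`, then `s = 0` (compare the coefficients of `X^{m-1}` at the first exponent `m` of `s`: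
`0` on the left, `w(0)² s_m` on the right). [cite: deShalit1987, Ch. I §3.12 Lemma (proof)] -/
theorem eq_zero_of_expand_two_eq [CharP K 2] (w s : K⟦X⟧) (u : K) (hw : constantCoeff w ≠ 0)
    (hs : ∀ n, coeff (2 * n) s = 0)
    (heq : expand 2 two_ne_zero (w * s) = C u * (w * s) + w * d⁄dX K (w * s)) : s = 0 := by
  classical
  by_contra hne
  have hex : ∃ m, coeff m s ≠ 0 := by
    by_contra hall
    push Not at hall
    exact hne (PowerSeries.ext fun k => by rw [hall k, map_zero])
  set m := Nat.find hex with hm_def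
  have hm : coeff m s ≠ 0 := Nat.find_spec hex
  have hlt : ∀ d < m, coeff d s = 0 := fun d hd => by
    have := Nat.find_min hex hd
    simpa using this
  -- `m` is odd
  obtain ⟨n₀, hn₀⟩ : ∃ n₀, m = 2 * n₀ + 1 := by
    rcases Nat.even_or_odd m with ⟨k, hk⟩ | ⟨k, hk⟩
    · exact absurd (hs k) (by rw [two_mul, ← hk]; exact hm)
    · exact ⟨k, hk⟩
  have h2 : (2 : K) = 0 := by
    have := CharP.cast_eq_zero K 2
    simpa using this
  -- compare the coefficients of `X^{2 n₀}`
  have hL : coeff (2 * n₀) (expand 2 two_ne_zero (w * s)) = 0 := by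
    rw [coeff_expand_mul]
    exact coeff_mul_eq_zero_of_lt hlt _ (by omega)
  have hR1 : coeff (2 * n₀) (C u * (w * s)) = 0 := by
    rw [coeff_C_mul, coeff_mul_eq_zero_of_lt hlt _ (by omega), mul_zero]
  have hR2 : coeff (2 * n₀) (w * d⁄dX K (w * s)) = constantCoeff w * (constantCoeff w * coeff m s) := by
    rw [coeff_mul, Finset.sum_eq_single (0, 2 * n₀)]
    · rw [coeff_zero_eq_constantCoeff, coeff_derivative, show 2 * n₀ + 1 = m by omega,
        coeff_mul_eq_of_lt hlt]
      have hc : ((2 * n₀ : ℕ) : K) + 1 = 1 := by push_cast; rw [h2, zero_mul, zero_add]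
      rw [hc, mul_one]
    · intro x hx hne'
      have hx' := Finset.mem_antidiagonal.mp hx
      have hlt2 : x.2 < 2 * n₀ := by
        by_contra hge
        push Not at hge
        exact hne' (Prod.ext (by omega) (by omega))
      rw [coeff_derivative, coeff_mul_eq_zero_of_lt hlt _ (by omega), zero_mul, mul_zero]
    · intro h
      exact absurd (Finset.mem_antidiagonal.mpr (by simp)) h
  have key := congrArg (coeff (2 * n₀)) heq
  rw [hL, map_add, hR1, hR2, zero_add] at key
  exact mul_ne_zero hw (mul_ne_zero hw hm) key.symm

end PowerSeries

namespace Literature.NumberTheory.GaloisRepresentations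

section LocalFieldSurj

open GaloisRepresentations.IsNonarchimedeanLocalField LubinTate ValuativeRel

variable (F : Type*) [Field F] [ValuativeRel F] [TopologicalSpace F] [IsNonarchimedeanLocalField F]

attribute [local instance] ltNormUniformSpace ltNormIsUniformAddGroup rk1 nF nE fintypeResidueField

variable {F}
variable {π : 𝒪[F]} (hπ : (valuation F).IsUniformizer (π : F)) (n : ℕ)

/-! ### Reduction modulo `π` of `𝒪[F]⟦X⟧` -/

variable (F) in
/-- Reduction of coefficients `𝒪[F]⟦X⟧ → 𝓀_F⟦X⟧`. [cite: deShalit1987, Ch. I §3.12] -/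
def redSeries : PowerSeries (LTCoeff F) →+* PowerSeries 𝓀[F] :=
  PowerSeries.map ((IsLocalRing.residue 𝒪[F]).comp (LTCoeff.of F).symm.toRingHom)

/-- Coefficients of the reduction. [cite: deShalit1987, Ch. I §3.12] -/
theorem coeff_redSeries (G : PowerSeries (LTCoeff F)) (k : ℕ) :
    PowerSeries.coeff k (redSeries F G) = IsLocalRing.residue 𝒪[F] ((LTCoeff.of F).symm (PowerSeries.coeff k G)) := by
  rw [redSeries, PowerSeries.coeff_map]
  rfl

include hπ in
/-- `x ↦ 0` in `𝓀_F` iff `π ∣ x`. [cite: deShalit1987, Ch. I §3.12] -/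
theorem residue_eq_zero_iff_mem (x : LTCoeff F) :
    IsLocalRing.residue 𝒪[F] ((LTCoeff.of F).symm x) = 0 ↔ x ∈ Ideal.span {LTCoeff.of F π} := by
  rw [IsLocalRing.residue_eq_zero_iff, maximalIdeal_eq_span_singleton hπ, Ideal.mem_span_singleton,
    Ideal.mem_span_singleton]
  exact Iff.rfl

include hπ in
/-- **`red G = 0 ↔ G ≡ 0 (mod π)`.** [cite: deShalit1987, Ch. I §3.12] -/
theorem redSeries_eq_zero_iff (G : PowerSeries (LTCoeff F)) :
    redSeries F G = 0 ↔ G ∈ coeffIdeal (Ideal.span {LTCoeff.of F π}) := by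
  constructor
  · intro h k
    have hk := congrArg (PowerSeries.coeff k) h
    rw [coeff_redSeries, map_zero] at hk
    exact (residue_eq_zero_iff_mem hπ _).mp hk
  · intro h
    ext k
    rw [coeff_redSeries, map_zero]
    exact (residue_eq_zero_iff_mem hπ _).mpr (h k)

include hπ in
/-- `G ≡ G' (mod π) ↔ red G = red G'`. [cite: deShalit1987, Ch. I §3.12] -/
theorem redSeries_eq_iff (G G' : PowerSeries (LTCoeff F)) :
    redSeries F G = redSeries F G' ↔ G - G' ∈ coeffIdeal (Ideal.span {LTCoeff.of F π}) := by
  rw [← redSeries_eq_zero_iff hπ, map_sub, sub_eq_zero]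

include hπ in
/-- `red π = 0`. [cite: deShalit1987, Ch. I §3.12] -/
theorem residue_of_pi : IsLocalRing.residue 𝒪[F] ((LTCoeff.of F).symm (LTCoeff.of F π)) = 0 :=
  (residue_eq_zero_iff_mem hπ _).mpr (Ideal.mem_span_singleton_self _)

/-- Reduction commutes with `d⁄dX`. [cite: deShalit1987, Ch. I §3.12] -/
theorem redSeries_derivative (G : PowerSeries (LTCoeff F)) :
    redSeries F (PowerSeries.derivative (LTCoeff F) G) = PowerSeries.derivative 𝓀[F] (redSeries F G) := by
  ext k
  simp only [redSeries, PowerSeries.coeff_map, PowerSeries.coeff_derivative, map_mul, map_add, map_natCast, map_one]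

/-- Reduction commutes with `expand`. [cite: deShalit1987, Ch. I §3.12] -/
theorem redSeries_expand (p : ℕ) (hp : p ≠ 0) (G : PowerSeries (LTCoeff F)) :
    redSeries F (PowerSeries.expand p hp G) = PowerSeries.expand p hp (redSeries F G) :=
  PowerSeries.map_expand p hp _ G

/-! ### The residue field has two elements: characteristic `2` -/

/-- `|𝓀_F| = 2 ⟹ char 𝓀_F = 2`. [cite: deShalit1987, Ch. I §3.12] -/
theorem charP_two_of_residueFieldCard (hq : residueFieldCard F = 2) : CharP 𝓀[F] 2 := by
  have h1 : ((Fintype.card 𝓀[F] : ℕ) : 𝓀[F]) = 0 := FiniteField.cast_card_eq_zero 𝓀[F]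
  rw [show Fintype.card 𝓀[F] = 2 by rw [← Nat.card_eq_fintype_card]; exact hq] at h1
  exact (CharP.charP_iff_prime_eq_zero Nat.prime_two).mpr h1

include hπ in
/-- At `q = 2`: `2 = π · u` for some `u ∈ 𝒪[F]`. [cite: deShalit1987, Ch. I §3.12] -/
theorem exists_two_eq_pi_mul (hq : residueFieldCard F = 2) : ∃ u : LTCoeff F, (2 : LTCoeff F) = LTCoeff.of F π * u := by
  haveI := charP_two_of_residueFieldCard (F := F) hq
  have h2 : (2 : LTCoeff F) ∈ Ideal.span {LTCoeff.of F π} := by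
    rw [← residue_eq_zero_iff_mem hπ]
    have : IsLocalRing.residue 𝒪[F] ((LTCoeff.of F).symm (2 : LTCoeff F)) = (2 : 𝓀[F]) := by
      rw [map_ofNat, map_ofNat]
    rw [this]
    have := CharP.cast_eq_zero 𝓀[F] 2
    simpa using this
  exact Ideal.mem_span_singleton'.mp h2 |>.imp fun u hu => by rw [← hu, mul_comm]

include hπ in
/-- `red f = X²` at `q = 2`. [cite: deShalit1987, Ch. I §3.12] -/
theorem redSeries_ltSer (hq : residueFieldCard F = 2) : redSeries F (ltSer F π) = PowerSeries.X ^ 2 := by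
  have h := (isLTSeries_LTCoeff (F := F) π)
  ext k
  rw [coeff_redSeries, PowerSeries.coeff_X_pow]
  have hk := h.dvd_coeff_sub k
  rw [hq] at hk
  obtain ⟨c, hc⟩ := hk
  have e : PowerSeries.coeff k (ltSer F π) = (if k = 2 then 1 else 0) + LTCoeff.of F π * c := by
    rw [← hc]; ring
  rw [e, map_add, map_add, map_mul, map_mul, residue_of_pi hπ, zero_mul, add_zero]
  split_ifs <;> simp

/-! ### The eigen-equation modulo `π` -/

include hπ in
/-- Cancellation: `π·H ≡ 0 (mod π²) ⟹ H ≡ 0 (mod π)`. [cite: deShalit1987, Ch. I §3.12] -/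
theorem mem_coeffIdeal_of_C_mul_mem_sq {H : PowerSeries (LTCoeff F)}
    (h : PowerSeries.C (LTCoeff.of F π) * H ∈ coeffIdeal (Ideal.span {LTCoeff.of F π ^ 2})) :
    H ∈ coeffIdeal (Ideal.span {LTCoeff.of F π}) := by
  haveI : IsDomain (LTCoeff F) := inferInstanceAs (IsDomain 𝒪[F])
  have hπ0 : LTCoeff.of F π ≠ 0 := fun h0 => hπ.ne_zero (by
    have := congrArg (fun x => (((LTCoeff.of F).symm x : 𝒪[F]) : F)) h0
    simpa using this)
  intro k
  have hk := h k
  rw [PowerSeries.coeff_C_mul, Ideal.mem_span_singleton] at hk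
  obtain ⟨c, hc⟩ := hk
  rw [Ideal.mem_span_singleton]
  refine ⟨c, mul_left_cancel₀ hπ0 ?_⟩
  rw [hc, pow_two, mul_assoc]

/-- ★ **The `𝒮`-eigen-equation modulo `π` at `q = 2`**: if `𝒮h = π·h` then, in `𝓀_F⟦X⟧`,
`h̄(X²) = ū·h̄ + ω̄_F · h̄'` where `2 = π u` (so `ū = 1` if `F = ℚ₂`, `ū = 0` if `F/ℚ₂` is ramified).
[cite: deShalit1987, Ch. I §3.12 Lemma (proof)] -/
theorem redSeries_expand_two_of_colemanTrace_eq (hq : residueFieldCard F = 2) (h : PowerSeries (LTCoeff F))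
    (hh : colemanTrace hπ n h = PowerSeries.C (LTCoeff.of F π) * h) {u : LTCoeff F}
    (hu : (2 : LTCoeff F) = LTCoeff.of F π * u) :
    PowerSeries.expand 2 two_ne_zero (redSeries F h) =
      PowerSeries.C (IsLocalRing.residue 𝒪[F] ((LTCoeff.of F).symm u)) * redSeries F h +
        redSeries F (invDiff (isLTRing_LTCoeff hπ) (isLTSeries_LTCoeff π)) *
          PowerSeries.derivative 𝓀[F] (redSeries F h) := by
  haveI := charP_two_of_residueFieldCard (F := F) hq
  set hA := isLTRing_LTCoeff (F := F) hπ
  set hf := isLTSeries_LTCoeff (F := F) π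
  set ω := invDiff hA hf
  -- `(𝒮h)∘f = π·(h∘f)` and `(𝒮h)∘f ≡ 2h - π ω h' (mod π²)`
  have h1 := subst_colemanTrace_sub_mem_coeffIdeal_sq hπ n hq h
  rw [hh, subst_C_mul (isLTSeries_ltSer π)] at h1
  have h2 : PowerSeries.C (LTCoeff.of F π) * (PowerSeries.subst (ltSer F π) h -
      (PowerSeries.C u * h - ω * PowerSeries.derivative (LTCoeff F) h)) ∈
      coeffIdeal (Ideal.span {LTCoeff.of F π ^ 2}) := by
    have e : PowerSeries.C (LTCoeff.of F π) * (PowerSeries.subst (ltSer F π) h -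
        (PowerSeries.C u * h - ω * PowerSeries.derivative (LTCoeff F) h)) =
        PowerSeries.C (LTCoeff.of F π) * PowerSeries.subst (ltSer F π) h -
          ((PowerSeries.C (LTCoeff.of F π * u) : PowerSeries (LTCoeff F)) * h -
            PowerSeries.C (LTCoeff.of F π) * (ω * PowerSeries.derivative (LTCoeff F) h)) := by
      rw [map_mul]; ring
    rw [e]
    have e2 : (PowerSeries.C (LTCoeff.of F π * u) : PowerSeries (LTCoeff F)) = (2 : PowerSeries (LTCoeff F)) := by
      rw [← hu, map_ofNat]
    rw [e2]
    exact h1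
  have h3 := mem_coeffIdeal_of_C_mul_mem_sq hπ h2
  -- `h∘f ≡ h(X²) (mod π)`
  have h4 : PowerSeries.subst (ltSer F π) h - PowerSeries.expand 2 two_ne_zero h ∈
      coeffIdeal (Ideal.span {LTCoeff.of F π}) := by
    have key : ∀ (q : ℕ) (hq0 : q ≠ 0) (hfq : IsLTSeries (LTCoeff.of F π) q (ltSer F π)), q = 2 →
        PowerSeries.subst (ltSer F π) h - PowerSeries.expand 2 two_ne_zero h ∈
          coeffIdeal (Ideal.span {LTCoeff.of F π}) := by
      rintro q hq0 hfq rfl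
      exact subst_sub_expand_mem_coeffIdeal hfq two_ne_zero h
    exact key (residueFieldCard F) (by rw [hq]; exact two_ne_zero) (isLTSeries_ltSer π) hq
  have h5 : PowerSeries.expand 2 two_ne_zero h - (PowerSeries.C u * h - ω * PowerSeries.derivative (LTCoeff F) h) ∈
      coeffIdeal (Ideal.span {LTCoeff.of F π}) := by
    have e : PowerSeries.expand 2 two_ne_zero h - (PowerSeries.C u * h - ω * PowerSeries.derivative (LTCoeff F) h) =
        (PowerSeries.subst (ltSer F π) h - (PowerSeries.C u * h - ω * PowerSeries.derivative (LTCoeff F) h)) -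
          (PowerSeries.subst (ltSer F π) h - PowerSeries.expand 2 two_ne_zero h) := by ring
    rw [e]
    exact sub_mem h3 h4
  have h6 := (redSeries_eq_iff hπ _ _).mpr h5
  haveI : CharP (PowerSeries 𝓀[F]) 2 :=
    charP_of_injective_algebraMap (R := 𝓀[F]) (A := PowerSeries 𝓀[F]) (fun a b hab => by
      have := congrArg PowerSeries.constantCoeff hab
      simpa using this) 2
  rw [redSeries_expand, map_sub, map_mul, map_mul, redSeries_derivative, sub_eq_add_neg, CharTwo.neg_eq] at h6
  rw [h6, redSeries, PowerSeries.map_C]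
  rfl

/-! ### Lifting units of `𝓀_F⟦X⟧` to `𝒩`-invariant units -/

/-- ★ Every unit `ḡ ∈ 𝓀_F⟦X⟧ˣ` is the reduction of an `𝒩`-invariant unit of `𝒪[F]⟦X⟧` (coefficientwise lift +
de Shalit I §3.10, `LubinTateColemanResidualLift.lean`). [cite: deShalit1987, Ch. I §3.10 Lemma] -/
theorem exists_colemanNorm_eq_redSeries_eq (gbar : (PowerSeries 𝓀[F])ˣ) :
    ∃ g : (PowerSeries (LTCoeff F))ˣ, colemanNorm hπ n (g : PowerSeries (LTCoeff F)) = g ∧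
      redSeries F (g : PowerSeries (LTCoeff F)) = gbar := by
  haveI : IsLocalRing (LTCoeff F) := inferInstanceAs (IsLocalRing 𝒪[F])
  -- coefficientwise lift
  set G₀ : PowerSeries (LTCoeff F) := PowerSeries.mk fun k =>
    LTCoeff.of F (Function.surjInv (IsLocalRing.residue_surjective (R := 𝒪[F])) (PowerSeries.coeff k (gbar : PowerSeries 𝓀[F])))
    with hG₀
  have hred : redSeries F G₀ = gbar := by
    ext k
    rw [coeff_redSeries, hG₀, PowerSeries.coeff_mk, RingEquiv.symm_apply_apply,
      Function.surjInv_eq (IsLocalRing.residue_surjective (R := 𝒪[F]))]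
  have hunit : IsUnit (PowerSeries.constantCoeff G₀) := by
    have h0 : IsUnit (PowerSeries.constantCoeff (gbar : PowerSeries 𝓀[F])) :=
      PowerSeries.isUnit_constantCoeff _ gbar.isUnit
    have hne : PowerSeries.constantCoeff (gbar : PowerSeries 𝓀[F]) ≠ 0 := h0.ne_zero
    rw [← hred, ← PowerSeries.coeff_zero_eq_constantCoeff_apply, coeff_redSeries,
      PowerSeries.coeff_zero_eq_constantCoeff_apply, Ne, IsLocalRing.residue_eq_zero_iff] at hne
    have : IsUnit ((LTCoeff.of F).symm (PowerSeries.constantCoeff G₀)) := by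
      by_contra hnu
      exact hne ((IsLocalRing.mem_maximalIdeal _).mpr hnu)
    exact this
  obtain ⟨G, hN, hG⟩ := exists_colemanNorm_eq_sub_mem_coeffIdeal hπ n (PowerSeries.isUnit_iff_constantCoeff.mpr hunit).unit
  refine ⟨G, hN, ?_⟩
  rw [IsUnit.unit_spec] at hG
  rw [← hred]
  exact (redSeries_eq_iff hπ _ _).mpr hG

/-! ### The reduction of Coleman's logarithmic derivative -/

/-- `red(δg) · X = ω̄ · ∂(red g)` where `∂ = X·dlog` on `𝓀⟦X⟧ˣ`: `X · red(δ g) = red ω · xdlog (red g)`.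
[cite: deShalit1987, Ch. I §3.12] -/
theorem X_mul_redSeries_logDeriv (g : (PowerSeries (LTCoeff F))ˣ) :
    PowerSeries.X * redSeries F (logDeriv hπ g) =
      redSeries F (invDiff (isLTRing_LTCoeff hπ) (isLTSeries_LTCoeff π)) *
        PowerSeries.xdlog (Units.map (redSeries F).toMonoidHom g) := by
  rw [logDeriv_def, map_mul, PowerSeries.xdlog_def, PowerSeries.dlog_def, PowerSeries.dlog_def, map_mul,
    redSeries_derivative, Units.coe_map, Units.coe_map_inv]
  simp only [RingHom.toMonoidHom_eq_coe, MonoidHom.coe_coe]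
  ring

/-! ### The decomposition `k = i + ρ` with `i` Cartier and `ρ` supported on even exponents -/

/-- The coefficients of the "Cartier part" of a coefficient sequence in characteristic `2`:
`i_n = c_n` for `n` odd, `i_{2n} = i_n^2`, `i_0 = 0`. [cite: deShalit1987, Ch. I §3.12] -/
def cartierCoeff {K : Type*} [CommRing K] (c : ℕ → K) : ℕ → K
  | 0 => 0
  | n + 1 => if (n + 1) % 2 = 1 then c (n + 1) else cartierCoeff c ((n + 1) / 2) ^ 2
  decreasing_by omega

/-- Odd coefficients are unchanged. [cite: deShalit1987, Ch. I §3.12] -/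
theorem cartierCoeff_odd {K : Type*} [CommRing K] (c : ℕ → K) (m : ℕ) :
    cartierCoeff c (2 * m + 1) = c (2 * m + 1) := by
  rw [cartierCoeff, if_pos (by omega)]

/-- Even coefficients are squares of the half-index ones. [cite: deShalit1987, Ch. I §3.12] -/
theorem cartierCoeff_two_mul {K : Type*} [CommRing K] (c : ℕ → K) (m : ℕ) :
    cartierCoeff c (2 * m) = cartierCoeff c m ^ 2 := by
  rcases m with _ | m
  · rw [mul_zero, cartierCoeff, zero_pow two_ne_zero]
  · rw [show 2 * (m + 1) = (2 * m + 1) + 1 by ring, cartierCoeff, if_neg (by omega),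
      show (2 * m + 1 + 1) / 2 = m + 1 by omega]

/-! ### The main step -/

/-- ★★★ **Coleman's `δ` is surjective modulo `π` onto the `𝒮`-eigenseries, at `q = 2`**
(de Shalit I §3.12, Lemma + first step of the Corollary, for `f = πX + X²` over any `F` with `|𝓀_F| = 2`,
e.g. `F = ℚ₂` with any uniformiser): if `𝒮h = π·h` then `h ≡ δg (mod π)` for some `𝒩`-invariant
PRINCIPAL unit `g ∈ 𝒪[F]⟦X⟧ˣ` (`g(0) ≡ 1 (mod π)`).  Proof: `k = X ω̄⁻¹ h̄ = i + ρ` with `i` Cartier (`= ∂ḡ₁` by Cartier's criterion, `ḡ₁` lifted to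
`g₁ ∈ ℳ_f` by §3.10) and `ρ` even-supported; `h₂ = h - δg₁` satisfies the eigen-equation mod `π` and
`h̄₂ = ω̄·s`, `s` odd-supported, so `s = 0` by the characteristic-`2` coefficient lemma.
[cite: deShalit1987, Ch. I §3.12 Corollary] -/
theorem exists_colemanNorm_eq_sub_logDeriv_mem (hq : residueFieldCard F = 2) (h : PowerSeries (LTCoeff F))
    (hh : colemanTrace hπ n h = PowerSeries.C (LTCoeff.of F π) * h) :
    ∃ g : (PowerSeries (LTCoeff F))ˣ, colemanNorm hπ n (g : PowerSeries (LTCoeff F)) = g ∧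
      PowerSeries.constantCoeff (g : PowerSeries (LTCoeff F)) - 1 ∈ Ideal.span {LTCoeff.of F π} ∧
      h - logDeriv hπ g ∈ coeffIdeal (Ideal.span {LTCoeff.of F π}) := by
  classical
  haveI := charP_two_of_residueFieldCard (F := F) hq
  haveI : Fact (Nat.Prime 2) := ⟨Nat.prime_two⟩
  set hA := isLTRing_LTCoeff (F := F) hπ
  set hf := isLTSeries_LTCoeff (F := F) π
  obtain ⟨u, hu⟩ := exists_two_eq_pi_mul hπ hq
  -- the reduced invariant differential `ω̄`, a unit with `ω̄(0) = 1`
  set ω := invDiff hA hf with hω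
  have hω0 : PowerSeries.constantCoeff (redSeries F ω) = 1 := by
    rw [← PowerSeries.coeff_zero_eq_constantCoeff_apply, coeff_redSeries, PowerSeries.coeff_zero_eq_constantCoeff_apply,
      hω, constantCoeff_invDiff, map_one, map_one]
  have hωu : IsUnit (redSeries F ω) := PowerSeries.isUnit_iff_constantCoeff.mpr (by rw [hω0]; exact isUnit_one)
  set W : (PowerSeries 𝓀[F])ˣ := hωu.unit with hW
  have hWval : (W : PowerSeries 𝓀[F]) = redSeries F ω := hωu.unit_spec
  set Winv : PowerSeries 𝓀[F] := ((W⁻¹ : (PowerSeries 𝓀[F])ˣ) : PowerSeries 𝓀[F]) with hWinv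
  have hWWinv : redSeries F ω * Winv = 1 := by rw [hWinv, ← hWval, Units.mul_inv]
  -- `k = X ω̄⁻¹ h̄`
  set k : PowerSeries 𝓀[F] := PowerSeries.X * Winv * redSeries F h with hk
  have hk0 : PowerSeries.constantCoeff k = 0 := by
    rw [hk, mul_assoc, ← PowerSeries.coeff_zero_eq_constantCoeff_apply, PowerSeries.coeff_zero_X_mul]
  -- the Cartier part `i`
  set i : PowerSeries 𝓀[F] := PowerSeries.mk (cartierCoeff fun m => PowerSeries.coeff m k) with hi
  have hi0 : PowerSeries.constantCoeff i = 0 := by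
    rw [← PowerSeries.coeff_zero_eq_constantCoeff_apply, hi, PowerSeries.coeff_mk, cartierCoeff]
  have hiC : PowerSeries.IsCartier 2 i := by
    intro m
    rw [hi, PowerSeries.coeff_mk, PowerSeries.coeff_mk, cartierCoeff_two_mul]
  have hiodd : ∀ m, PowerSeries.coeff (2 * m + 1) i = PowerSeries.coeff (2 * m + 1) k := fun m => by
    rw [hi, PowerSeries.coeff_mk, cartierCoeff_odd]
  -- `i = ∂ ḡ₁` with `ḡ₁(0) = 1` (Cartier's criterion), `ḡ₁` lifted to `g₁ ∈ ℳ_f`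
  set gbar : (PowerSeries 𝓀[F])ˣ := PowerSeries.limitUnit (p := 2) (h := i) with hgbar_def
  have hgbar : PowerSeries.xdlog gbar = i := PowerSeries.xdlog_limitUnit hi0 hiC
  have hgbar0 : PowerSeries.constantCoeff (gbar : PowerSeries 𝓀[F]) = 1 := by
    rw [hgbar_def, PowerSeries.limitUnit, IsUnit.unit_spec]
    exact PowerSeries.constantCoeff_limitSeries
  obtain ⟨g₁, hN₁, hred₁⟩ := exists_colemanNorm_eq_redSeries_eq hπ n gbar
  have hg₁0 : PowerSeries.constantCoeff (g₁ : PowerSeries (LTCoeff F)) - 1 ∈ Ideal.span {LTCoeff.of F π} := by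
    rw [← residue_eq_zero_iff_mem hπ, map_sub, map_sub, map_one, map_one, sub_eq_zero,
      ← PowerSeries.coeff_zero_eq_constantCoeff_apply, ← coeff_redSeries, hred₁,
      PowerSeries.coeff_zero_eq_constantCoeff_apply, hgbar0]
  have hgbar' : Units.map (redSeries F).toMonoidHom g₁ = gbar := Units.ext (by
    rw [Units.coe_map, RingHom.toMonoidHom_eq_coe, MonoidHom.coe_coe, hred₁])
  -- `h₂ = h - δ g₁` is again an eigenseries
  set h₂ := h - logDeriv hπ g₁ with hh₂
  have hh₂S : colemanTrace hπ n h₂ = PowerSeries.C (LTCoeff.of F π) * h₂ := by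
    have e1 : colemanTrace hπ n (logDeriv hπ g₁) = PowerSeries.C (LTCoeff.of F π) * logDeriv hπ g₁ :=
      colemanTrace_logDeriv_of_colemanNorm_eq hπ n g₁ hN₁
    have e2 : colemanTrace hπ n h = colemanTrace hπ n h₂ + colemanTrace hπ n (logDeriv hπ g₁) := by
      rw [← colemanTrace_add, hh₂, sub_add_cancel]
    rw [hh₂, mul_sub, ← hh, ← e1, e2, hh₂, add_sub_cancel_right]
  -- `X ω̄⁻¹ h̄₂ = k - i =: ρ`, even-supported
  have hXδ : PowerSeries.X * Winv * redSeries F (logDeriv hπ g₁) = i := by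
    rw [mul_right_comm, X_mul_redSeries_logDeriv, mul_right_comm, hWWinv, one_mul, hgbar', hgbar]
  have hXh₂ : PowerSeries.X * Winv * redSeries F h₂ = k - i := by
    rw [hh₂, map_sub, mul_sub, hXδ, ← hk]
  have hρeven : ∀ m, PowerSeries.coeff (2 * m + 1) (k - i) = 0 := fun m => by
    rw [map_sub, hiodd, sub_self]
  -- `h̄₂ = ω̄ · s` with `s = X⁻¹ ρ` odd-supported
  set s : PowerSeries 𝓀[F] := PowerSeries.mk fun m => PowerSeries.coeff (m + 1) (k - i) with hs
  have hXs : PowerSeries.X * s = k - i := by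
    ext m
    rcases m with _ | m
    · rw [PowerSeries.coeff_zero_X_mul, map_sub, PowerSeries.coeff_zero_eq_constantCoeff_apply, hk0,
        PowerSeries.coeff_zero_eq_constantCoeff_apply, hi0, sub_zero]
    · rw [PowerSeries.coeff_succ_X_mul, hs, PowerSeries.coeff_mk]
  have hsodd : ∀ m, PowerSeries.coeff (2 * m) s = 0 := fun m => by
    rw [hs, PowerSeries.coeff_mk, hρeven]
  have hh₂ωs : redSeries F h₂ = redSeries F ω * s := by
    have e : PowerSeries.X * redSeries F h₂ = PowerSeries.X * (redSeries F ω * s) := by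
      calc PowerSeries.X * redSeries F h₂
          = (redSeries F ω * Winv) * (PowerSeries.X * redSeries F h₂) := by rw [hWWinv, one_mul]
        _ = redSeries F ω * (PowerSeries.X * Winv * redSeries F h₂) := by ring
        _ = redSeries F ω * (PowerSeries.X * s) := by rw [hXh₂, hXs]
        _ = PowerSeries.X * (redSeries F ω * s) := by ring
    -- cancel `X`
    ext m
    have := congrArg (PowerSeries.coeff (m + 1)) e
    rwa [PowerSeries.coeff_succ_X_mul, PowerSeries.coeff_succ_X_mul] at this
  -- the eigen-equation for `h₂` mod `π` forces `s = 0`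
  have heq := redSeries_expand_two_of_colemanTrace_eq hπ n hq h₂ hh₂S hu
  rw [hh₂ωs] at heq
  have hs0 : s = 0 := PowerSeries.eq_zero_of_expand_two_eq (redSeries F ω) s _ (by rw [hω0]; exact one_ne_zero) hsodd heq
  -- conclude: `red h₂ = 0`
  refine ⟨g₁, hN₁, hg₁0, ?_⟩
  rw [← hh₂, ← redSeries_eq_zero_iff hπ, hh₂ωs, hs0, mul_zero]

end LocalFieldSurj

end Literature.NumberTheory.GaloisRepresentations
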